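import Mathlib
import Summits.PneNP.PneNP.Theorems.CnfIdealGenLengthRankDefectRepresentationsQuadrantCapture
import Summits.PneNP.PneNP.Theorems.CnfIdealGenLengthRankDefectRepresentationsCutLemmaMonotoneCuts
import Summits.HodgeConjecture.HodgeConjecture.Theorems.HodgeLocusCensusRankReduction

/-!
# Crux `RankDefectRepresentations` (stmt-PneNP-18923), line `rank-dehn-ladder`: SHARP ANTIPODAL DOMINATION (registered tool stub
# `stub_sharpAntipodal`, lead g15 RESHAPE 9; memo `Cruxes/RankDefectRepresentations/Lines/rank-dehn-ladder-g15.md` §3)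

Setting (two-family instances, as in `Theorems/…TwoFamilyCutDomination`, `…QuadrantCapture`): rows `x : ι` and columns `y : ι'` of a matrix `D`
carry first-family colours `colourI (row x) : Fin n → Bool` and second-family colours `colourJ (row x) : Fin n' → Bool`.  For a double cut
`(B, B′)` the QUADRANT `B × B′` consists of the rows and columns whose colour pair lies in `B × B′`; its internal rectangles are
`R¹¹(S₁,S′₁)` = rows of types `S₁ × S′₁`, columns of types `(B ∖ S₁) × (B′ ∖ S′₁)` (`S₁ ⊆ B`, `S′₁ ⊆ B′`); the ANTIPODAL quadrant `Bᶜ × B′ᶜ` has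
the internal rectangles `R²²(S₂,S′₂)` (`S₂ ⊆ Bᶜ`, `S′₂ ⊆ B′ᶜ`).

THEOREM (`stub_sharpAntipodal`, constant ONE; lead g14's `Theorems/…AntipodalDomination`, p705259, had the constant `4`).  If every first
rectangle `rect row col B B′ true true D` of `D` has rank `≤ c₀`, then for every `(B,B′)` and every sub-rectangle `R¹¹(S₁,S′₁)` of the quadrant
`B × B′`, of rank `a`, there is ONE matrix `W` of rank `≤ a` such that every internal rectangle of the antipodal quadrant of `D − W` has rank
`≤ c₀ − a`.  PROOF.  Take an invertible `a × a` minor `A = D[X₀,Y₀]` of `R¹¹(S₁,S′₁)` (a matrix of rank `a` over a field has one: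
`exists_submatrix_det_ne_zero`, landed in `Summits/HodgeConjecture/…/HodgeLocusCensusRankReduction`), and `W := D[·,Y₀] · A⁻¹ · D[X₀,·]`.  For
`S₂ ⊆ Bᶜ`, `S′₂ ⊆ B′ᶜ` the block matrix `M = [[A, E],[F, G]]` with rows `X₀ ∪ rows(S₂ × S′₂)` and columns `Y₀ ∪ cols((Bᶜ∖S₂) × (B′ᶜ∖S′₂))` is a
submatrix of the first rectangle of `D` at `(S₁ ∪ S₂, S′₁ ∪ S′₂)`, hence `rank M ≤ c₀`; the LDU factorisation
(`Matrix.fromBlocks_eq_of_invertible₁₁`) gives `rank M = rank A + rank (G − F A⁻¹ E) = a + rank R²²(S₂,S′₂)(D − W)`.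
So after paying `rank W ≤ a ≤ c₀` the rectangle budgets of two antipodal quadrants SPLIT EXACTLY (`a + (c₀ − a)`).
HONEST FRAMING: elementary linear algebra in the negative (tool) lane of the crux; P ≠ NP is not moved; F-N2 is a FRONTIER formal rung.
-/

set_option linter.dupNamespace false -- `Summit.PneNP.PneNP.…`: summit = sub-problem name (D-0017)

namespace Summit.PneNP.PneNP.Theorems.CnfIdealGenLengthRankDefectRepresentationsSharpAntipodal

open Matrix
open Summit.PneNP.PneNP.Theorems.CnfIdealGenLengthRankDefectRepresentationsTwoFamilyCutDomination (colourI colourJ)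
open Summit.PneNP.PneNP.Theorems.CnfIdealGenLengthRankDefectRepresentationsQuadrantCapture (rect rect_apply rank_add_of_disjoint)
open Summit.PneNP.PneNP.Theorems.CnfIdealGenLengthRankDefectRepresentationsCutLemmaMonotoneCuts (rank_pad_le)
open Summit.HodgeConjecture.HodgeConjecture.HodgeLocus.Census.RankReduction (exists_submatrix_det_ne_zero)

variable {K : Type} [Field K]

section Tools

variable {ι ι' : Type} [Fintype ι] [Fintype ι'] [DecidableEq ι] [DecidableEq ι']

/-- The rank of a zero-padded block equals the rank of the block. [folklore] -/
theorem rank_padded_eq (P : ι → Prop) (Q : ι' → Prop) [DecidablePred P] [DecidablePred Q] (M : Matrix ι ι' K) :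
    (Matrix.of fun x y => if P x ∧ Q y then M x y else 0).rank =
      (M.submatrix (Subtype.val : {x // P x} → ι) (Subtype.val : {y // Q y} → ι')).rank := by
  apply le_antisymm
  · have e : (Matrix.of fun x y => if P x ∧ Q y then M x y else 0) =
        Matrix.of fun x y => if hx : P x then (if hy : Q y then
          (M.submatrix (Subtype.val : {x // P x} → ι) (Subtype.val : {y // Q y} → ι')) ⟨x, hx⟩ ⟨y, hy⟩ else 0) else 0 := by
      ext x y
      by_cases hx : P x <;> by_cases hy : Q y <;> simp [hx, hy]
    rw [e]
    exact rank_pad_le P Q _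
  · have e : M.submatrix (Subtype.val : {x // P x} → ι) (Subtype.val : {y // Q y} → ι') =
        (Matrix.of fun x y => if P x ∧ Q y then M x y else 0).submatrix
          (Subtype.val : {x // P x} → ι) (Subtype.val : {y // Q y} → ι') := by
      ext x y
      simp [x.2, y.2]
    rw [e]
    exact Matrix.rank_submatrix_le _ _ _

/-- A matrix padded by zero blocks has the same rank. [folklore] -/
theorem rank_fromBlocks_zero {α β γ δ : Type} [Fintype α] [Fintype β] [Fintype γ] [Fintype δ]
    [DecidableEq α] [DecidableEq β] [DecidableEq γ] [DecidableEq δ] (A : Matrix α γ K) :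
    (Matrix.fromBlocks A 0 0 (0 : Matrix β δ K)).rank = A.rank := by
  classical
  apply le_antisymm
  · -- the padded block is a zero-extension of a submatrix-copy of `A`
    have e : Matrix.fromBlocks A 0 0 (0 : Matrix β δ K) =
        Matrix.of fun (u : α ⊕ β) (v : γ ⊕ δ) => if hu : u.isLeft = true then (if hv : v.isLeft = true then
          ((Matrix.fromBlocks A 0 0 (0 : Matrix β δ K)).submatrix
            (Subtype.val : {u : α ⊕ β // u.isLeft = true} → α ⊕ β)
            (Subtype.val : {v : γ ⊕ δ // v.isLeft = true} → γ ⊕ δ)) ⟨u, hu⟩ ⟨v, hv⟩ else 0) else 0 := by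
      ext u v
      rcases u with u | u <;> rcases v with v | v <;> simp
    rw [e]
    refine (rank_pad_le _ _ _).trans ?_
    have e2 : (Matrix.fromBlocks A 0 0 (0 : Matrix β δ K)).submatrix
        (Subtype.val : {u : α ⊕ β // u.isLeft = true} → α ⊕ β)
        (Subtype.val : {v : γ ⊕ δ // v.isLeft = true} → γ ⊕ δ) =
        A.submatrix (fun u : {u : α ⊕ β // u.isLeft = true} => u.1.getLeft u.2)
          (fun v : {v : γ ⊕ δ // v.isLeft = true} => v.1.getLeft v.2) := by
      ext ⟨u, hu⟩ ⟨v, hv⟩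
      rcases u with u | u
      · rcases v with v | v
        · simp
        · simp at hv
      · simp at hu
    rw [e2]
    exact Matrix.rank_submatrix_le _ _ _
  · have e : A = (Matrix.fromBlocks A 0 0 (0 : Matrix β δ K)).submatrix Sum.inl Sum.inl := by
      ext i j; simp
    conv_lhs => rw [e]
    exact Matrix.rank_submatrix_le _ _ _

/-- The rank of a block-diagonal matrix is the sum of the ranks of its blocks. [folklore] -/
theorem rank_fromBlocks_diagonal {α β γ δ : Type} [Fintype α] [Fintype β] [Fintype γ] [Fintype δ]
    [DecidableEq α] [DecidableEq β] [DecidableEq γ] [DecidableEq δ]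
    (A : Matrix α γ K) (S : Matrix β δ K) :
    (Matrix.fromBlocks A 0 0 S).rank = A.rank + S.rank := by
  classical
  have hsplit : Matrix.fromBlocks A 0 0 S = Matrix.fromBlocks A 0 0 (0 : Matrix β δ K) + Matrix.fromBlocks (0 : Matrix α γ K) 0 0 S := by
    rw [Matrix.fromBlocks_add]; simp
  rw [hsplit, rank_add_of_disjoint (fun u : α ⊕ β => u.isLeft = true) (fun v : γ ⊕ δ => v.isLeft = true)]
  · rw [rank_fromBlocks_zero]
    congr 1
    have e : Matrix.fromBlocks (0 : Matrix α γ K) 0 0 S = (Matrix.fromBlocks S 0 0 (0 : Matrix α γ K)).submatrix Sum.swap Sum.swap := by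
      rw [Matrix.fromBlocks_submatrix_sum_swap_sum_swap]
    rw [e, show (Matrix.fromBlocks S 0 0 (0 : Matrix α γ K)).submatrix Sum.swap Sum.swap =
        (Matrix.fromBlocks S 0 0 (0 : Matrix α γ K)).reindex (Equiv.sumComm β α) (Equiv.sumComm δ γ) from rfl,
      Matrix.rank_reindex, rank_fromBlocks_zero]
  · intro u v h
    rcases u with u | u <;> rcases v with v | v <;> simp_all
  · intro u v h
    rcases u with u | u <;> rcases v with v | v <;> simp_all

end Tools

section Main

variable {n n' : ℕ} {ι ι' : Type} [Fintype ι] [Fintype ι'] [DecidableEq ι] [DecidableEq ι']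

/-- **Schur step.**  If `A` is invertible then `rank [[A, E],[F, G]] = rank A + rank (G − F A⁻¹ E)`. [folklore: LDU] -/
theorem rank_fromBlocks_of_invertible₁₁ {α β γ : Type} [Fintype α] [Fintype β] [Fintype γ]
    [DecidableEq α] [DecidableEq β] [DecidableEq γ]
    (A : Matrix α α K) (E : Matrix α γ K) (F : Matrix β α K) (G : Matrix β γ K) [Invertible A] :
    (Matrix.fromBlocks A E F G).rank = A.rank + (G - F * ⅟A * E).rank := by
  rw [Matrix.fromBlocks_eq_of_invertible₁₁ A E F G]
  have hL : IsUnit (Matrix.fromBlocks (1 : Matrix α α K) 0 (F * ⅟A) (1 : Matrix β β K)).det := by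
    rw [Matrix.det_fromBlocks_zero₁₂]; simp
  have hU : IsUnit (Matrix.fromBlocks (1 : Matrix α α K) (⅟A * E) 0 (1 : Matrix γ γ K)).det := by
    rw [Matrix.det_fromBlocks_zero₂₁]; simp
  rw [Matrix.rank_mul_eq_left_of_isUnit_det _ _ hU, Matrix.rank_mul_eq_right_of_isUnit_det _ _ hL,
    rank_fromBlocks_diagonal]

/-- **SHARP ANTIPODAL DOMINATION** (registered stub `stub_sharpAntipodal` of `Cruxes/RankDefectRepresentations/Lines/rank_dehn_ladder.lean`,
lead g15 RESHAPE 9; constant ONE).  See the module docstring. -/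
theorem stub_sharpAntipodal :
    ∀ (K : Type) [Field K] (n n' : ℕ) (ι ι' : Type) [Fintype ι] [Fintype ι'] [DecidableEq ι] [DecidableEq ι']
      (row : ι → Fin n ⊕ Fin n' → Bool) (col : ι' → Fin n ⊕ Fin n' → Bool) (D : Matrix ι ι' K) (c₀ : ℕ),
      (∀ B B', (Summit.PneNP.PneNP.Theorems.CnfIdealGenLengthRankDefectRepresentationsQuadrantCapture.rect row col B B' true true D).rank ≤ c₀) →
      ∀ (B S₁ : Finset (Fin n → Bool)) (B' S'₁ : Finset (Fin n' → Bool)), S₁ ⊆ B → S'₁ ⊆ B' →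
        ∃ W : Matrix ι ι' K,
          W.rank ≤ (Matrix.of fun x y =>
              if Summit.PneNP.PneNP.Theorems.CnfIdealGenLengthRankDefectRepresentationsTwoFamilyCutDomination.colourI (row x) ∈ S₁ ∧
                  Summit.PneNP.PneNP.Theorems.CnfIdealGenLengthRankDefectRepresentationsTwoFamilyCutDomination.colourJ (row x) ∈ S'₁ ∧
                  Summit.PneNP.PneNP.Theorems.CnfIdealGenLengthRankDefectRepresentationsTwoFamilyCutDomination.colourI (col y) ∈ B \ S₁ ∧
                  Summit.PneNP.PneNP.Theorems.CnfIdealGenLengthRankDefectRepresentationsTwoFamilyCutDomination.colourJ (col y) ∈ B' \ S'₁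
              then D x y else 0).rank ∧
          ∀ (S₂ : Finset (Fin n → Bool)) (S'₂ : Finset (Fin n' → Bool)), S₂ ⊆ Bᶜ → S'₂ ⊆ B'ᶜ →
            (Matrix.of fun x y =>
                if Summit.PneNP.PneNP.Theorems.CnfIdealGenLengthRankDefectRepresentationsTwoFamilyCutDomination.colourI (row x) ∈ S₂ ∧
                    Summit.PneNP.PneNP.Theorems.CnfIdealGenLengthRankDefectRepresentationsTwoFamilyCutDomination.colourJ (row x) ∈ S'₂ ∧
                    Summit.PneNP.PneNP.Theorems.CnfIdealGenLengthRankDefectRepresentationsTwoFamilyCutDomination.colourI (col y) ∈ Bᶜ \ S₂ ∧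
                    Summit.PneNP.PneNP.Theorems.CnfIdealGenLengthRankDefectRepresentationsTwoFamilyCutDomination.colourJ (col y) ∈ B'ᶜ \ S'₂
                then (D - W) x y else 0).rank +
              (Matrix.of fun x y =>
                if Summit.PneNP.PneNP.Theorems.CnfIdealGenLengthRankDefectRepresentationsTwoFamilyCutDomination.colourI (row x) ∈ S₁ ∧
                    Summit.PneNP.PneNP.Theorems.CnfIdealGenLengthRankDefectRepresentationsTwoFamilyCutDomination.colourJ (row x) ∈ S'₁ ∧
                    Summit.PneNP.PneNP.Theorems.CnfIdealGenLengthRankDefectRepresentationsTwoFamilyCutDomination.colourI (col y) ∈ B \ S₁ ∧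
                    Summit.PneNP.PneNP.Theorems.CnfIdealGenLengthRankDefectRepresentationsTwoFamilyCutDomination.colourJ (col y) ∈ B' \ S'₁
                then D x y else 0).rank ≤ c₀ := by
  intro K _ n n' ι ι' _ _ _ _ row col D c₀ hrect B S₁ B' S'₁ hS hS'
  classical
  -- the sub-rectangle `R¹¹(S₁,S′₁)` and an invertible maximal minor of it
  set R₁ : Matrix ι ι' K := Matrix.of fun x y =>
      if colourI (row x) ∈ S₁ ∧ colourJ (row x) ∈ S'₁ ∧ colourI (col y) ∈ B \ S₁ ∧ colourJ (col y) ∈ B' \ S'₁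
      then D x y else 0 with hR₁
  obtain ⟨rows, cols, hdet⟩ := exists_submatrix_det_ne_zero R₁
  set A : Matrix (Fin R₁.rank) (Fin R₁.rank) K := R₁.submatrix rows cols with hAdef
  -- the selected rows/columns lie in the right types (otherwise a zero row/column of `A`)
  have hrows : ∀ i, colourI (row (rows i)) ∈ S₁ ∧ colourJ (row (rows i)) ∈ S'₁ := by
    intro i
    by_contra h
    apply hdet
    refine Matrix.det_eq_zero_of_row_eq_zero i fun j => ?_
    simp only [hAdef, Matrix.submatrix_apply, hR₁, Matrix.of_apply]
    rw [if_neg]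
    tauto
  have hcols : ∀ j, colourI (col (cols j)) ∈ B \ S₁ ∧ colourJ (col (cols j)) ∈ B' \ S'₁ := by
    intro j
    by_contra h
    apply hdet
    refine Matrix.det_eq_zero_of_column_eq_zero j fun i => ?_
    simp only [hAdef, Matrix.submatrix_apply, hR₁, Matrix.of_apply]
    rw [if_neg]
    tauto
  have hA : ∀ i j, A i j = D (rows i) (cols j) := by
    intro i j
    simp only [hAdef, Matrix.submatrix_apply, hR₁, Matrix.of_apply]
    rw [if_pos ⟨(hrows i).1, (hrows i).2, (hcols j).1, (hcols j).2⟩]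
  haveI : Invertible A := A.invertibleOfIsUnitDet (isUnit_iff_ne_zero.mpr hdet)
  -- the dominating matrix
  set P : Matrix ι (Fin R₁.rank) K := Matrix.of fun x j => D x (cols j) with hP
  set Q : Matrix (Fin R₁.rank) ι' K := Matrix.of fun i y => D (rows i) y with hQ
  refine ⟨P * ⅟A * Q, ?_, ?_⟩
  · calc (P * ⅟A * Q).rank ≤ (P * ⅟A).rank := Matrix.rank_mul_le_left _ _
      _ ≤ P.rank := Matrix.rank_mul_le_left _ _
      _ ≤ Fintype.card (Fin R₁.rank) := Matrix.rank_le_card_width _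
      _ = R₁.rank := Fintype.card_fin _
  · intro S₂ S'₂ hS₂ hS'₂
    -- row / column index types of the antipodal rectangle
    let ρ := {x : ι // colourI (row x) ∈ S₂ ∧ colourJ (row x) ∈ S'₂}
    let κ := {y : ι' // colourI (col y) ∈ Bᶜ \ S₂ ∧ colourJ (col y) ∈ B'ᶜ \ S'₂}
    set E : Matrix (Fin R₁.rank) κ K := Q.submatrix id Subtype.val with hE
    set F : Matrix ρ (Fin R₁.rank) K := P.submatrix Subtype.val id with hF
    set G : Matrix ρ κ K := D.submatrix Subtype.val Subtype.val with hG
    set M : Matrix (Fin R₁.rank ⊕ ρ) (Fin R₁.rank ⊕ κ) K := Matrix.fromBlocks A E F G with hM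
    -- (1) `M` is a submatrix of the first rectangle of `D` at `(S₁ ∪ S₂, S′₁ ∪ S′₂)`
    set T : Matrix ι ι' K := rect row col (S₁ ∪ S₂) (S'₁ ∪ S'₂) true true D with hT
    have hTD : ∀ (u : Fin R₁.rank ⊕ ρ) (v : Fin R₁.rank ⊕ κ),
        T (Sum.elim rows Subtype.val u) (Sum.elim cols Subtype.val v) = D (Sum.elim rows Subtype.val u) (Sum.elim cols Subtype.val v) := by
      intro u v
      have hr : colourI (row (Sum.elim rows Subtype.val u)) ∈ S₁ ∪ S₂ ∧ colourJ (row (Sum.elim rows Subtype.val u)) ∈ S'₁ ∪ S'₂ := by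
        rcases u with i | x
        · exact ⟨Finset.mem_union_left _ (hrows i).1, Finset.mem_union_left _ (hrows i).2⟩
        · exact ⟨Finset.mem_union_right _ x.2.1, Finset.mem_union_right _ x.2.2⟩
      have hc : colourI (col (Sum.elim cols Subtype.val v)) ∉ S₁ ∪ S₂ ∧ colourJ (col (Sum.elim cols Subtype.val v)) ∉ S'₁ ∪ S'₂ := by
        rcases v with j | y
        · have h1 := (hcols j).1
          have h2 := (hcols j).2
          rw [Finset.mem_sdiff] at h1 h2
          refine ⟨?_, ?_⟩
          · rw [Finset.mem_union, not_or]
            exact ⟨h1.2, fun h => (Finset.mem_compl.mp (hS₂ h)) h1.1⟩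
          · rw [Finset.mem_union, not_or]
            exact ⟨h2.2, fun h => (Finset.mem_compl.mp (hS'₂ h)) h2.1⟩
        · have h1 := y.2.1
          have h2 := y.2.2
          rw [Finset.mem_sdiff, Finset.mem_compl] at h1 h2
          refine ⟨?_, ?_⟩
          · rw [Finset.mem_union, not_or]
            exact ⟨fun h => h1.1 (hS h), h1.2⟩
          · rw [Finset.mem_union, not_or]
            exact ⟨fun h => h2.1 (hS' h), h2.2⟩
      have hcond : (decide (colourI (row (Sum.elim rows Subtype.val u)) ∈ S₁ ∪ S₂) = true ∧
            decide (colourJ (row (Sum.elim rows Subtype.val u)) ∈ S'₁ ∪ S'₂) = true) ∧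
          (decide (colourI (col (Sum.elim cols Subtype.val v)) ∈ S₁ ∪ S₂) = !true ∧
            decide (colourJ (col (Sum.elim cols Subtype.val v)) ∈ S'₁ ∪ S'₂) = !true) := by
        simp only [Bool.not_true, decide_eq_true_eq, decide_eq_false_iff_not]
        exact ⟨hr, hc⟩
      rw [hT, rect_apply, if_pos hcond]
    have hMT : M = T.submatrix (Sum.elim rows Subtype.val) (Sum.elim cols Subtype.val) := by
      ext u v
      rw [Matrix.submatrix_apply, hTD]
      rcases u with i | x <;> rcases v with j | y
      · simp [hM, hA]
      · simp [hM, hE, hQ]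
      · simp [hM, hF, hP]
      · simp [hM, hG]
    have hMc : M.rank ≤ c₀ := by
      rw [hMT]
      exact (Matrix.rank_submatrix_le _ _ _).trans (hrect _ _)
    -- (2) Schur: `rank M = a + rank (G − F A⁻¹ E)`
    have hArank : A.rank = R₁.rank := by
      rw [Matrix.rank_of_isUnit A ((Matrix.isUnit_iff_isUnit_det A).mpr (isUnit_iff_ne_zero.mpr hdet)), Fintype.card_fin]
    have hSchur := rank_fromBlocks_of_invertible₁₁ A E F G
    -- (3) the Schur complement is the antipodal rectangle of `D − W`
    have hSW : G - F * ⅟A * E = (D - P * ⅟A * Q).submatrix (Subtype.val : ρ → ι) (Subtype.val : κ → ι') := by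
      rw [Matrix.submatrix_sub, hG, hF, hE]
      congr 1
    have hpad := rank_padded_eq (fun x : ι => colourI (row x) ∈ S₂ ∧ colourJ (row x) ∈ S'₂)
      (fun y : ι' => colourI (col y) ∈ Bᶜ \ S₂ ∧ colourJ (col y) ∈ B'ᶜ \ S'₂) (D - P * ⅟A * Q)
    have e4 : (Matrix.of fun x y =>
        if colourI (row x) ∈ S₂ ∧ colourJ (row x) ∈ S'₂ ∧ colourI (col y) ∈ Bᶜ \ S₂ ∧ colourJ (col y) ∈ B'ᶜ \ S'₂
        then (D - P * ⅟A * Q) x y else 0) =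
        (Matrix.of fun x y =>
          if (colourI (row x) ∈ S₂ ∧ colourJ (row x) ∈ S'₂) ∧ (colourI (col y) ∈ Bᶜ \ S₂ ∧ colourJ (col y) ∈ B'ᶜ \ S'₂)
          then (D - P * ⅟A * Q) x y else 0) := by
      ext x y
      simp only [Matrix.of_apply, and_assoc]
    rw [e4, hpad, ← hSW]
    have h1 : A.rank + (G - F * ⅟A * E).rank ≤ c₀ := by
      rw [← hSchur, ← hM]; exact hMc
    rw [hArank] at h1
    omega

end Main

end Summit.PneNP.PneNP.Theorems.CnfIdealGenLengthRankDefectRepresentationsSharpAntipodal
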